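import Summits.HodgeConjecture.HodgeConjecture.Theorems.AnchorTransportVariationalHodgeQuasiProjective
import Summits.HodgeConjecture.HodgeConjecture.Theorems.AnchorTransportTargetIffHodgeConjecture
import Literature.AlgebraicGeometry.HodgeTheory.HyperplaneSectionFamilyGoodFibres
import Literature.AlgebraicGeometry.HodgeTheory.IsoTransport
import Literature.AlgebraicGeometry.HodgeTheory.HyperplaneClassRational
import Literature.AlgebraicGeometry.HodgeTheory.HodgeTypeExteriorProduct
import Literature.AlgebraicGeometry.HodgeTheory.HodgeGenericQbarDescentFiniteMonodromyInputs
import HarnessLib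

/-!
# Route AffinePartDecay — crux `WeakLefschetzAlgebraicClasses` (stmt-HodgeConjecture-1968), line `sideways_vhc_sweep`: sideways transfer across the smooth hyperplane sections, fibre form

Support for the registered stub (T) `stub_sidewaysTransfer` of the skeleton
`Cruxes/WeakLefschetzAlgebraicClasses/Lines/sideways_vhc_sweep.lean`: SIDEWAYS BY VHC — under the
variational Hodge conjecture for PROJECTIVE smooth families (the printed form, Charles–Schnell
Conj. 11.3.1, verbatim the hypothesis shape of the stub), a rational `(p,p)`-class `c` on a smooth
projective `X ⊆ ℙᴺ` of dimension `n + 1 ≥ 2` which is algebraic on ONE smooth `n`-dimensional hyperplane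
section is algebraic on EVERY smooth `n`-dimensional hyperplane section.

Here the hyperplane sections are the FIBRES of the family of all hyperplane sections of `X`
(`g = (toX ≫ (X ⟶ Spec ℂ), proj) : 𝒴 ⟶ Spec ℂ × (ℙᴺ)^*`, the tree's
`Motives/UniversalHyperplaneSectionFamily…` at the constant family `X ⟶ Spec ℂ`) — the currency of the
tree's monodromy / good-locus / Thomas-family packages — rather than the zero schemes
`e.hypersurfaceSection (linForm a)` of the stub (whose scheme-theoretic identification with the fibres
is the separate, purely algebro-geometric input the stub still needs).

* `sidewaysTransfer_sectionFamily` — the theorem. Mechanism (as in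
  `Theorems.vhcTwo_succ_of_vhcTwo_of_sweep`, Thomas's `s`-direction, here over the point base): the good
  locus `G ⊆ Spec ℂ × (ℙᴺ)^*` (`Motives.SectionFamily.exists_goodLocus`) is open in an irreducible smooth
  scheme, contains both points, and over it `g` is a smooth projective family of `n`-folds
  (`HodgeTheory.SectionFamily.isSmoothProjective_fiberOver_of_mem_goodLocus`,
  `isSmoothProjectiveFamily_snd_openSubschemeOverι`) with quasi-projective total space, hence projective
  over `G` in Hartshorne's sense (`exists_isClosedImmersion_of_isSmoothProjectiveFamily`); the class
  `toX^* c` is fibrewise rational of type `(p,p)` (functoriality of Hodge types between smooth projective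
  varieties); VHC transports algebraicity from one fibre to the other.
* `isPullback_lift_toSpecOver_snd`, `exists_iso_fiberOver_sectionFamily_proj` — the fibre of `g` over
  `(⋆, t)` is the fibre `X ∩ H_t` of `proj : 𝒴 ⟶ (ℙᴺ)^*` over `t` (pasting of cartesian squares);
* `sidewaysTransfer_proj` — the same transfer stated with the fibres of `proj`, the currency of
  `HodgeTheory.smoothFiberLocus` and `nonempty_universalHyperplaneSectionLocalSystem`.

No definition, no named fact, no `sorry`.

## References

* [VoisinHodgeII2003] C. Voisin, Hodge Theory and Complex Algebraic Geometry II, CUP 2003, §2.1.1 and §3.2.2.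
* [Grothendieck1966deRham] A. Grothendieck, On the de Rham cohomology of algebraic varieties,
  Publ. Math. IHÉS 29 (1966), footnote 13.
* [CharlesSchnell2014Notes] F. Charles, C. Schnell, Notes on absolute Hodge classes (2014), Conj. 11.3.1.
* [Thomas2005Nodes] R. P. Thomas, Nodes and the Hodge conjecture, J. Algebraic Geom. 14 (2005), §5.
-/

noncomputable section

set_option linter.dupNamespace false

open CategoryTheory CategoryTheory.Limits AlgebraicGeometry TopologicalSpace MonoidalCategory
  CartesianMonoidalCategory
open Literature.AlgebraicGeometry.Motives Literature.AlgebraicGeometry.HodgeTheory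
open Literature.AlgebraicGeometry.Motives.UniversalHyperplaneSection
open Literature.AlgebraicGeometry.Motives.SectionFamily Literature.AlgebraicGeometry.HodgeTheory.SectionFamily

namespace Summit.HodgeConjecture.HodgeConjecture.Theorems

/-- **Sideways transfer by VHC across the smooth hyperplane sections of `X ⊆ ℙᴺ`, fibre form.** Let
`X` be smooth projective of dimension `n + 1`, `n ≥ 1`, `ι : X ⟶ ℙᴺ` a closed immersion, `c` a
rational class of Hodge type `(p,p)` on `X`, and `g : 𝒴 ⟶ Spec ℂ × (ℙᴺ)^*` the family of all hyperplane
sections of `X`. Assume the variational Hodge conjecture for projective smooth families. If the fibres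
of `g` over `b₀` and `b` are smooth projective `n`-folds and `c` restricts to an algebraic class on the
fibre over `b₀`, then `c` restricts to an algebraic class on the fibre over `b`.
[cite: VoisinHodgeII2003, §3.2.2] [cite: CharlesSchnell2014Notes, Conj. 11.3.1] [cite: Thomas2005Nodes, §5] -/
theorem sidewaysTransfer_sectionFamily
    (hV : ∀ ⦃k : ℕ⦄ ⦃𝒳 S : SchemeOver ℂ⦄ (f : 𝒳 ⟶ S), IsSmoothProjectiveFamily f k →
      (∃ (N : ℕ) (ι : 𝒳 ⟶ projectiveSpace N ℂ ⊗ S), IsClosedImmersion ι.left ∧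
        ι ≫ CartesianMonoidalCategory.snd (projectiveSpace N ℂ) S = f) →
      IrreducibleSpace S.left → AlgebraicGeometry.Smooth S.hom →
      ∀ (q : ℕ) (A : complexBetti 𝒳 (2 * q)),
      (∀ s : ComplexPoints S, IsRationalClass (complexBetti.map (fiberι f s) (2 * q) A) ∧
        IsOfHodgeType k (fiberOver f s) (2 * q) q q (complexBetti.map (fiberι f s) (2 * q) A)) →
      (∃ s₀ : ComplexPoints S,
        complexBetti.map (fiberι f s₀) (2 * q) A ∈ algebraicClasses (fiberOver f s₀) q) →
      ∀ s : ComplexPoints S,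
        complexBetti.map (fiberι f s) (2 * q) A ∈ algebraicClasses (fiberOver f s) q)
    {n p N : ℕ} {X : SchemeOver ℂ} (hX : IsSmoothProjective (n + 1) X) (hn : 1 ≤ n)
    (ι : X ⟶ projectiveSpace N ℂ) [IsClosedImmersion ι.left]
    (c : complexBetti X (2 * p)) (hc : IsRationalClass c) (hcH : IsOfHodgeType (n + 1) X (2 * p) p p c)
    (b₀ b : ComplexPoints (specOver ℂ ℂ ⊗ dualProjectiveSpace N ℂ))
    (hb₀ : IsSmoothProjective n
      (fiberOver (CartesianMonoidalCategory.lift (toX N ι ≫ toSpecOver X) (proj N ι)) b₀))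
    (halg₀ : complexBetti.map
        (fiberι (CartesianMonoidalCategory.lift (toX N ι ≫ toSpecOver X) (proj N ι)) b₀ ≫ toX N ι) (2 * p) c ∈
      algebraicClasses (fiberOver (CartesianMonoidalCategory.lift (toX N ι ≫ toSpecOver X) (proj N ι)) b₀) p)
    (hb : IsSmoothProjective n
      (fiberOver (CartesianMonoidalCategory.lift (toX N ι ≫ toSpecOver X) (proj N ι)) b)) :
    complexBetti.map
        (fiberι (CartesianMonoidalCategory.lift (toX N ι ≫ toSpecOver X) (proj N ι)) b ≫ toX N ι) (2 * p) c ∈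
      algebraicClasses (fiberOver (CartesianMonoidalCategory.lift (toX N ι ≫ toSpecOver X) (proj N ι)) b) p := by
  -- the constant family `f : X ⟶ Spec ℂ` over the point base `S = Spec ℂ`
  have hf : IsSmoothProjectiveFamily (toSpecOver X) (n + 1) := isSmoothProjectiveFamily_toSpecOver hX
  haveI : IrreducibleSpace (specOver ℂ ℂ).left := irreducibleSpace_specOver_left
  haveI : IsAffine (specOver ℂ ℂ).left := inferInstanceAs (IsAffine (Spec (CommRingCat.of ℂ)))
  haveI : AlgebraicGeometry.Smooth (specOver ℂ ℂ).hom := smooth_specOver_hom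
  haveI : LocallyOfFiniteType (specOver ℂ ℂ).hom := inferInstance
  haveI : IsSeparated (specOver ℂ ℂ).hom := inferInstance
  obtain ⟨d, hd⟩ := exists_smoothOfRelativeDimension_of_smooth (specOver ℂ ℂ).hom
  haveI := hd
  haveI : IsAffineHom ι.left := inferInstance
  have he : ∀ t : ComplexPoints (specOver ℂ ℂ), IsClosedImmersion (fiberι (toSpecOver X) t ≫ ι).left := by
    intro t
    haveI := isIso_fiberι_toSpecOver (X := X) t
    haveI : IsIso (fiberι (toSpecOver X) t).left :=
      inferInstanceAs (IsIso ((Over.forget _).map (fiberι (toSpecOver X) t)))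
    rw [Over.comp_left]
    infer_instance
  have hN : 2 ≤ N := by
    have h := le_of_isClosedImmersion_projectiveSpace hX ι
    omega
  have h𝒳q : IsQuasiProjectiveOver X := IsQuasiProjectiveOver.of_isProjectiveOver hX.isProjectiveOver
  -- the good locus and the family over it
  obtain ⟨G, hGsm, hGiff⟩ := exists_goodLocus (toSpecOver X) ι hf (d := d) hN
  haveI := hGsm
  have hfib := isSmoothProjective_fiberOver_of_mem_goodLocus (toSpecOver X) ι hf (d := d) hN hn he (AlgPoints.map (fst (specOver ℂ ℂ) (dualProjectiveSpace N ℂ)) b₀) G hGsm hGiff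
  have hb₀G : b₀.pt ∈ G := (hGiff b₀).mpr hb₀.smoothOfRelativeDimension
  have hbG : b.pt ∈ G := (hGiff b).mpr hb.smoothOfRelativeDimension
  haveI : IsProper (CartesianMonoidalCategory.lift (toX N ι ≫ toSpecOver X) (proj N ι)).left := isProper_sectionFamily_left (toSpecOver X) _ hf
  have hF := isSmoothProjectiveFamily_snd_openSubschemeOverι (CartesianMonoidalCategory.lift (toX N ι ≫ toSpecOver X) (proj N ι)) G hGsm hfib
  haveI : IsOpenImmersion (openSubschemeOverι (specOver ℂ ℂ ⊗ dualProjectiveSpace N ℂ) G).left :=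
    inferInstanceAs (IsOpenImmersion G.ι)
  have hPq : IsQuasiProjectiveOver (dualProjectiveSpace N ℂ) :=
    IsQuasiProjectiveOver.of_isProjectiveOver (isSmoothProjective_projectiveSpace_holds ℂ N).isProjectiveOver
  have h𝒴q : IsQuasiProjectiveOver (universalHyperplaneSection N ι) :=
    IsQuasiProjectiveOver.of_isClosedImmersion (emb N _) (isQuasiProjectiveOver_tensorObj_of_field h𝒳q hPq)
  have hq := isQuasiProjectiveOver_familyPullback (CartesianMonoidalCategory.lift (toX N ι ≫ toSpecOver X) (proj N ι))
    (openSubschemeOverι (specOver ℂ ℂ ⊗ dualProjectiveSpace N ℂ) G) inferInstance h𝒴q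
  -- the family over `G` is projective in Hartshorne's sense
  obtain ⟨M, κ, hκ, hκf⟩ := exists_isClosedImmersion_of_isSmoothProjectiveFamily hF hq
  -- the base `G`: irreducible and smooth
  have hP := isSmoothProjective_projectiveSpace_holds ℂ N
  haveI := hP.smoothOfRelativeDimension
  haveI : Smooth (dualProjectiveSpace N ℂ).hom := SmoothOfRelativeDimension.smooth N _
  haveI : IrreducibleSpace (specOver ℂ ℂ ⊗ dualProjectiveSpace N ℂ).left := by
    haveI := hP.geometricallyIrreducible
    haveI : UniversallyOpen (dualProjectiveSpace N ℂ).hom := inferInstance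
    exact inferInstanceAs (IrreducibleSpace ↥(pullback (specOver ℂ ℂ).hom (dualProjectiveSpace N ℂ).hom))
  have hBirr : IrreducibleSpace (openSubschemeOver (specOver ℂ ℂ ⊗ dualProjectiveSpace N ℂ) G).left := by
    change IrreducibleSpace G
    exact isIrreducible_iff_irreducibleSpace.mp ⟨⟨_, hb₀G⟩,
      (PreirreducibleSpace.isPreirreducible_univ (X := (specOver ℂ ℂ ⊗ dualProjectiveSpace N ℂ).left)).open_subset G.isOpen
        (Set.subset_univ _)⟩
  have hBsm : AlgebraicGeometry.Smooth (openSubschemeOver (specOver ℂ ℂ ⊗ dualProjectiveSpace N ℂ) G).hom := by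
    haveI := smooth_tensorObj_hom (specOver ℂ ℂ) (dualProjectiveSpace N ℂ)
    change AlgebraicGeometry.Smooth (G.ι ≫ (specOver ℂ ℂ ⊗ dualProjectiveSpace N ℂ).hom)
    infer_instance
  -- lifting the points of `G`
  have hrange : Set.range (AlgPoints.map (L := ℂ) (openSubschemeOverι (specOver ℂ ℂ ⊗ dualProjectiveSpace N ℂ) G)) =
      {P | P.pt ∈ G} := by
    rw [AlgPoints.range_map_of_isOpenImmersion_holds]
    ext P
    change P.pt ∈ G.ι.opensRange ↔ P.pt ∈ G
    rw [Scheme.Opens.opensRange_ι]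
  -- the class `toX^* c` on the family over `G`, its fibre restrictions
  set ct : complexBetti (universalHyperplaneSection N ι) (2 * p) := complexBetti.map (toX N ι) (2 * p) c with hct
  have key : ∀ u : ComplexPoints (openSubschemeOver (specOver ℂ ℂ ⊗ dualProjectiveSpace N ℂ) G),
      complexBetti.map (fiberι (familyPullback.snd (CartesianMonoidalCategory.lift (toX N ι ≫ toSpecOver X) (proj N ι)) (openSubschemeOverι (specOver ℂ ℂ ⊗ dualProjectiveSpace N ℂ) G)) u) (2 * p)
          (complexBetti.map (familyPullback.fst (CartesianMonoidalCategory.lift (toX N ι ≫ toSpecOver X) (proj N ι)) (openSubschemeOverι (specOver ℂ ℂ ⊗ dualProjectiveSpace N ℂ) G)) (2 * p) ct) ∈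
          algebraicClasses (fiberOver (familyPullback.snd (CartesianMonoidalCategory.lift (toX N ι ≫ toSpecOver X) (proj N ι)) (openSubschemeOverι (specOver ℂ ℂ ⊗ dualProjectiveSpace N ℂ) G)) u) p ↔
        complexBetti.map (fiberι (CartesianMonoidalCategory.lift (toX N ι ≫ toSpecOver X) (proj N ι)) (AlgPoints.map (openSubschemeOverι (specOver ℂ ℂ ⊗ dualProjectiveSpace N ℂ) G) u)) (2 * p) ct ∈
          algebraicClasses (fiberOver (CartesianMonoidalCategory.lift (toX N ι ≫ toSpecOver X) (proj N ι)) (AlgPoints.map (openSubschemeOverι (specOver ℂ ℂ ⊗ dualProjectiveSpace N ℂ) G) u)) p := by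
    intro u
    rw [map_fiberι_familyPullback]
    exact mem_algebraicClasses_map_iff_of_iso (fiberOverFamilyPullbackIso _ _ u)
  -- the fibre restrictions of `toX^* c` are pull-backs of `c` along `Y_b ⟶ X`
  have hct_map : ∀ b' : ComplexPoints (specOver ℂ ℂ ⊗ dualProjectiveSpace N ℂ),
      complexBetti.map (fiberι (CartesianMonoidalCategory.lift (toX N ι ≫ toSpecOver X) (proj N ι)) b') (2 * p) ct = complexBetti.map (fiberι (CartesianMonoidalCategory.lift (toX N ι ≫ toSpecOver X) (proj N ι)) b' ≫ toX N ι) (2 * p) c := by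
    intro b'
    rw [hct, ← CategoryTheory.comp_apply, ← complexBetti.map_comp]
  have hct_fib : ∀ b' : ComplexPoints (specOver ℂ ℂ ⊗ dualProjectiveSpace N ℂ), b'.pt ∈ G →
      IsRationalClass (complexBetti.map (fiberι (CartesianMonoidalCategory.lift (toX N ι ≫ toSpecOver X) (proj N ι)) b') (2 * p) ct) ∧
      IsOfHodgeType n (fiberOver (CartesianMonoidalCategory.lift (toX N ι ≫ toSpecOver X) (proj N ι)) b') (2 * p) p p (complexBetti.map (fiberι (CartesianMonoidalCategory.lift (toX N ι ≫ toSpecOver X) (proj N ι)) b') (2 * p) ct) := by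
    intro b' hb'
    rw [hct_map]
    exact ⟨hc.map _, hcH.map_of_isSmoothProjective (hfib b' hb') hX _⟩
  have hA' : ∀ u : ComplexPoints (openSubschemeOver (specOver ℂ ℂ ⊗ dualProjectiveSpace N ℂ) G),
      IsRationalClass (complexBetti.map (fiberι (familyPullback.snd (CartesianMonoidalCategory.lift (toX N ι ≫ toSpecOver X) (proj N ι))
          (openSubschemeOverι (specOver ℂ ℂ ⊗ dualProjectiveSpace N ℂ) G)) u) (2 * p)
          (complexBetti.map (familyPullback.fst (CartesianMonoidalCategory.lift (toX N ι ≫ toSpecOver X) (proj N ι)) (openSubschemeOverι (specOver ℂ ℂ ⊗ dualProjectiveSpace N ℂ) G)) (2 * p) ct)) ∧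
        IsOfHodgeType n (fiberOver (familyPullback.snd (CartesianMonoidalCategory.lift (toX N ι ≫ toSpecOver X) (proj N ι)) (openSubschemeOverι (specOver ℂ ℂ ⊗ dualProjectiveSpace N ℂ) G)) u)
          (2 * p) p p
          (complexBetti.map (fiberι (familyPullback.snd (CartesianMonoidalCategory.lift (toX N ι ≫ toSpecOver X) (proj N ι)) (openSubschemeOverι (specOver ℂ ℂ ⊗ dualProjectiveSpace N ℂ) G)) u)
            (2 * p)
            (complexBetti.map (familyPullback.fst (CartesianMonoidalCategory.lift (toX N ι ≫ toSpecOver X) (proj N ι)) (openSubschemeOverι (specOver ℂ ℂ ⊗ dualProjectiveSpace N ℂ) G))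
              (2 * p) ct)) := by
    intro u
    have hmem : (AlgPoints.map (openSubschemeOverι (specOver ℂ ℂ ⊗ dualProjectiveSpace N ℂ) G) u).pt ∈ G := by
      have h : AlgPoints.map (openSubschemeOverι (specOver ℂ ℂ ⊗ dualProjectiveSpace N ℂ) G) u ∈
          Set.range (AlgPoints.map (L := ℂ) (openSubschemeOverι (specOver ℂ ℂ ⊗ dualProjectiveSpace N ℂ) G)) := ⟨u, rfl⟩
      rw [hrange] at h
      exact h
    obtain ⟨hr, hh⟩ := hct_fib _ hmem
    rw [map_fiberι_familyPullback]
    exact ⟨hr.map _, hh.map_of_isSmoothProjective (hF.isSmoothProjective u) (hfib _ hmem) _⟩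
  -- VHC over `G`, from the anchor `b₀`
  obtain ⟨u₀, hu₀⟩ : b₀ ∈ Set.range (AlgPoints.map (L := ℂ) (openSubschemeOverι (specOver ℂ ℂ ⊗ dualProjectiveSpace N ℂ) G)) := by
    rw [hrange]; exact hb₀G
  have hanch : complexBetti.map (fiberι (CartesianMonoidalCategory.lift (toX N ι ≫ toSpecOver X) (proj N ι)) b₀) (2 * p) ct ∈ algebraicClasses (fiberOver (CartesianMonoidalCategory.lift (toX N ι ≫ toSpecOver X) (proj N ι)) b₀) p := by
    rw [hct_map]; exact halg₀
  have hall := hV _ hF ⟨M, κ, hκ, hκf⟩ hBirr hBsm p _ hA' ⟨u₀, (key u₀).2 (by rw [hu₀]; exact hanch)⟩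
  obtain ⟨u, rfl⟩ : b ∈ Set.range (AlgPoints.map (L := ℂ) (openSubschemeOverι (specOver ℂ ℂ ⊗ dualProjectiveSpace N ℂ) G)) := by
    rw [hrange]; exact hbG
  rw [← hct_map]
  exact (key u).1 (hall u)

/-! ### From the fibres of `g` over `Spec ℂ × (ℙᴺ)^*` to the fibres of `proj` over `(ℙᴺ)^*` -/

/-- The square `Spec ℂ ⟶ Spec ℂ × (ℙᴺ)^*` (the point `(⋆, t)`), `𝟙`, `pr₂`, `t` is cartesian (the first
factor is the point). [folklore] -/
theorem isPullback_lift_toSpecOver_snd {N : ℕ} (t : ComplexPoints (dualProjectiveSpace N ℂ)) :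
    IsPullback (CartesianMonoidalCategory.lift (toSpecOver (specOver ℂ ℂ)) t) (𝟙 (specOver ℂ ℂ))
      (snd (specOver ℂ ℂ) (dualProjectiveSpace N ℂ)) t := by
  refine IsPullback.of_isLimit' ⟨by rw [CartesianMonoidalCategory.lift_snd, Category.id_comp]⟩
    (PullbackCone.IsLimit.mk _ (fun c => c.snd) (fun c => ?_) (fun c => Category.comp_id _)
      (fun c m _ h₂ => by simpa using h₂))
  refine CartesianMonoidalCategory.hom_ext _ _ ?_ ?_
  · exact (Literature.AlgebraicGeometry.Motives.eq_toSpecOver _).trans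
      (Literature.AlgebraicGeometry.Motives.eq_toSpecOver _).symm
  · rw [Category.assoc, CartesianMonoidalCategory.lift_snd]
    exact c.condition.symm

/-- **The fibre of the family `g = (toX ≫ (X ⟶ Spec ℂ), proj)` of all hyperplane sections of `X` over
the point `(⋆, t)` is the fibre `X ∩ H_t` of `proj` over `t`**, compatibly with the inclusions into
`𝒴` (pasting of cartesian squares, `pr₂ ∘ g = proj`). [cite: VoisinHodgeII2003, §3.2.2] -/
theorem exists_iso_fiberOver_sectionFamily_proj {N : ℕ} {X : SchemeOver ℂ} (ι : X ⟶ projectiveSpace N ℂ)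
    (t : ComplexPoints (dualProjectiveSpace N ℂ)) :
    ∃ φ : fiberOver (CartesianMonoidalCategory.lift (toX N ι ≫ toSpecOver X) (proj N ι))
          (CartesianMonoidalCategory.lift (toSpecOver (specOver ℂ ℂ)) t) ≅ fiberOver (proj N ι) t,
      φ.hom ≫ fiberι (proj N ι) t =
        fiberι (CartesianMonoidalCategory.lift (toX N ι ≫ toSpecOver X) (proj N ι))
          (CartesianMonoidalCategory.lift (toSpecOver (specOver ℂ ℂ)) t) := by
  have h1 := isPullback_fiberι (CartesianMonoidalCategory.lift (toX N ι ≫ toSpecOver X) (proj N ι))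
    (CartesianMonoidalCategory.lift (toSpecOver (specOver ℂ ℂ)) t)
  have h12 := h1.paste_vert (isPullback_lift_toSpecOver_snd t)
  rw [CartesianMonoidalCategory.lift_snd, Category.comp_id] at h12
  have h3 := isPullback_fiberι (proj N ι) t
  exact ⟨h12.isoIsPullback _ _ h3, IsPullback.isoIsPullback_hom_fst _ _ _ _⟩

/-- **Sideways transfer by VHC, in terms of the fibres of `proj : 𝒴 ⟶ (ℙᴺ)^*`** (the currency of
`HodgeTheory.smoothFiberLocus` / `nonempty_universalHyperplaneSectionLocalSystem`): under the
variational Hodge conjecture for projective smooth families, for `X ⊆ ℙᴺ` smooth projective of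
dimension `n + 1 ≥ 2` and a rational `(p,p)`-class `c` on `X`, if the hyperplane sections
`X ∩ H_{t₀}`, `X ∩ H_t` (fibres of `proj`) are smooth projective `n`-folds and `c|_{X ∩ H_{t₀}}` is
algebraic, then `c|_{X ∩ H_t}` is algebraic. [cite: VoisinHodgeII2003, §3.2.2] [cite: CharlesSchnell2014Notes, Conj. 11.3.1] -/
theorem sidewaysTransfer_proj
    (hV : ∀ ⦃k : ℕ⦄ ⦃𝒳 S : SchemeOver ℂ⦄ (f : 𝒳 ⟶ S), IsSmoothProjectiveFamily f k →
      (∃ (N : ℕ) (ι : 𝒳 ⟶ projectiveSpace N ℂ ⊗ S), IsClosedImmersion ι.left ∧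
        ι ≫ CartesianMonoidalCategory.snd (projectiveSpace N ℂ) S = f) →
      IrreducibleSpace S.left → AlgebraicGeometry.Smooth S.hom →
      ∀ (q : ℕ) (A : complexBetti 𝒳 (2 * q)),
      (∀ s : ComplexPoints S, IsRationalClass (complexBetti.map (fiberι f s) (2 * q) A) ∧
        IsOfHodgeType k (fiberOver f s) (2 * q) q q (complexBetti.map (fiberι f s) (2 * q) A)) →
      (∃ s₀ : ComplexPoints S,
        complexBetti.map (fiberι f s₀) (2 * q) A ∈ algebraicClasses (fiberOver f s₀) q) →
      ∀ s : ComplexPoints S,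
        complexBetti.map (fiberι f s) (2 * q) A ∈ algebraicClasses (fiberOver f s) q)
    {n p N : ℕ} {X : SchemeOver ℂ} (hX : IsSmoothProjective (n + 1) X) (hn : 1 ≤ n)
    (ι : X ⟶ projectiveSpace N ℂ) [IsClosedImmersion ι.left]
    (c : complexBetti X (2 * p)) (hc : IsRationalClass c) (hcH : IsOfHodgeType (n + 1) X (2 * p) p p c)
    (t₀ t : ComplexPoints (dualProjectiveSpace N ℂ))
    (ht₀ : IsSmoothProjective n (fiberOver (proj N ι) t₀))
    (halg₀ : complexBetti.map (fiberι (proj N ι) t₀ ≫ toX N ι) (2 * p) c ∈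
      algebraicClasses (fiberOver (proj N ι) t₀) p)
    (ht : IsSmoothProjective n (fiberOver (proj N ι) t)) :
    complexBetti.map (fiberι (proj N ι) t ≫ toX N ι) (2 * p) c ∈ algebraicClasses (fiberOver (proj N ι) t) p := by
  obtain ⟨φ₀, hφ₀⟩ := exists_iso_fiberOver_sectionFamily_proj ι t₀
  obtain ⟨φ, hφ⟩ := exists_iso_fiberOver_sectionFamily_proj ι t
  have h := sidewaysTransfer_sectionFamily hV hX hn ι c hc hcH
    (CartesianMonoidalCategory.lift (toSpecOver (specOver ℂ ℂ)) t₀)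
    (CartesianMonoidalCategory.lift (toSpecOver (specOver ℂ ℂ)) t) (ht₀.of_iso φ₀.symm)
    (by
      rw [← hφ₀, Category.assoc, complexBetti.map_comp, CategoryTheory.comp_apply]
      exact (mem_algebraicClasses_map_iff_of_iso φ₀).2 halg₀)
    (ht.of_iso φ.symm)
  rw [← hφ, Category.assoc, complexBetti.map_comp, CategoryTheory.comp_apply] at h
  exact (mem_algebraicClasses_map_iff_of_iso φ).1 h

end Summit.HodgeConjecture.HodgeConjecture.Theorems

end
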